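import Literature.Probability.LatticeModels.SahiThirdOrderCorrelation
import Literature.Probability.Percolation.GhostFieldMagnetization
import HarnessLib

/-!
# `NoHeavyLowerTail` (crux stmt-CriticalPhenomena-4575), abstract sunflower cubic: CALIBRATION AGAINST SAHI'S `E₃` —
# Lemma A for a triple of up-sets, in the region "conditional Harris fails at some shadow", implies Kahn's Conjecture 5 for that triple

Support file (seat `prim-ineq-gen-2` gen 32; `--supports stmt-CriticalPhenomena-4575`).  Nothing is asserted about the crux or about Sahi's
conjecture; no `sorry`, no named facts, no definitions, standard axioms.  Memo: run/shared/lean/prim/prim-ineq-gen-2/CUBIC-SIGN-LAW-GEN32.md §4.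

SETTING.  Three events `G₁, G₂, G₃` (the CORE SHADOWS of a three-petal sunflower in `PC*` form: `E_k = G_i ∩ G_j`, core `A = G₁ ∩ G₂ ∩ G₃`);
Lemma A's slack is `LA = μ(G₁G₂G₃)² − μ(G₁G₂)μ(G₁G₃)μ(G₂G₃)` and the lineage's (C1-law), A-side, asserts `LA ≥ 0` whenever
`μ(G₁G₂G₃) ≥ μ(at most one G_i)`.  Write `σ₃ = μ(G₁G₂G₃) − μ(G₁G₂)μ(G₃)`, `σ₂ = μ(G₁G₂G₃) − μ(G₁G₃)μ(G₂)` (Harris slacks, `≥ 0` for up-sets),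
`ρ_{ij} = μ(G_iG_j) − μ(G_i)μ(G_j)` (`≥ 0`), `κ₁ = μ(G₁G₂G₃)μ(G₁) − μ(G₁G₂)μ(G₁G₃)` (Harris for `G₂, G₃` CONDITIONED on `G₁`; either sign).

RESULTS (identities for every finite measure; inequalities for `prodBernoulli` and up-sets) [this work]:
* `sahiE3_eq_cov` — **Sahi's functional is a quantitative Kahn statement**: `E₃(G₁,G₂,G₃) = σ₂ + σ₃ − μ(G₁)·ρ₂₃` (Kahn 2022, Thm. 2:
  `σ₂ = σ₃ = 0 ⟹ ρ₂₃ = 0`; Sahi/Kahn's Conjecture 5: `μ(G₁)ρ₂₃ ≤ σ₂ + σ₃`).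
* `LA_eq_kappa_sigma` — `LA = μ(G₁G₂)·κ₃' + μ(G₁G₂G₃)·σ₃` with `κ₃' = μ(G₁G₂G₃)μ(G₃) − μ(G₁G₃)μ(G₂G₃)`; hence (`LA_nonneg_of_condHarris`) conditional
  Harris at one shadow gives Lemma A for ALL `p` (this is how the meet–join stratum of gen 29 works).
* `mul_LA_eq_sahi` — **`μ(G₁)·LA = μ(G₁G₂)μ(G₁G₃)·E₃(G₁,G₂,G₃) + κ₁·σ₃ − μ(G₁G₂)·σ₂·ρ₁₃`**.
* **`sahiE3_mul_nonneg_of_LA_nonneg`**: for up-sets under a product measure, `κ₁ ≤ 0 ∧ LA ≥ 0 ⟹ μ(G₁G₂)μ(G₁G₃)·E₃(G₁,G₂,G₃) ≥ 0`, and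
  (`sahiE3_nonneg_of_LA_nonneg`) `E₃ ≥ 0` if moreover `μ(G₁G₂)μ(G₁G₃) > 0`.  So on `{a ≥ b} ∩ {κ₁ ≤ 0}` the lineage's (C1-law) IMPLIES Kahn's
  Conjecture 5 for the arbitrary up-set triple `(G₁,G₂,G₃)` — the cubic is at least as hard as that regime of Sahi's conjecture; conversely the
  lineage's weakest row `(1+a)AG ≥ e₃` IS Conjecture 5 on sunflower complements (`…SahiSunflowerGladkovSquare`).
[cite: Kahn2022, Thm. 2 and Conj. 5 (arXiv pp. 2–3)]; [cite: LiebSahi2021, eq. (2.1)]; [cite: Grimmett1999, Thm. (2.4) p. 34 (Harris)]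
-/

noncomputable section

namespace Summit.CriticalPhenomena.PercolationContinuityZ3.Theorems.SunflowerPartition

namespace SahiCalibration

open MeasureTheory
open Literature.Probability.LatticeModels Literature.Probability.Percolation

section Identities

variable {Ω : Type*} [MeasurableSpace Ω] (μ : Measure Ω) (G₁ G₂ G₃ : Set Ω)

/-- **`E₃ = σ₂ + σ₃ − μ(G₁)·ρ₂₃`** (Sahi's third-order functional as a quantitative form of Kahn's Theorem 2).
[cite: Kahn2022, Thm. 2 (arXiv p. 2)] -/
theorem sahiE3_eq_cov :
    sahiE3 μ G₁ G₂ G₃ =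
      (μ.real (G₁ ∩ G₂ ∩ G₃) - μ.real (G₁ ∩ G₃) * μ.real G₂) + (μ.real (G₁ ∩ G₂ ∩ G₃) - μ.real (G₁ ∩ G₂) * μ.real G₃) -
        μ.real G₁ * (μ.real (G₂ ∩ G₃) - μ.real G₂ * μ.real G₃) := by
  rw [sahiE3_def]; ring

/-- **`LA = μ(G₁G₂)·κ₃' + μ(G₁G₂G₃)·σ₃`** with `κ₃' = μ(G₁G₂G₃)μ(G₃) − μ(G₁G₃)μ(G₂G₃)` (conditional Harris at the shadow `G₃`) and
`σ₃ = μ(G₁G₂G₃) − μ(G₁G₂)μ(G₃)`. [this work] -/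
theorem LA_eq_kappa_sigma :
    μ.real (G₁ ∩ G₂ ∩ G₃) ^ 2 - μ.real (G₁ ∩ G₂) * μ.real (G₁ ∩ G₃) * μ.real (G₂ ∩ G₃) =
      μ.real (G₁ ∩ G₂) * (μ.real (G₁ ∩ G₂ ∩ G₃) * μ.real G₃ - μ.real (G₁ ∩ G₃) * μ.real (G₂ ∩ G₃)) +
        μ.real (G₁ ∩ G₂ ∩ G₃) * (μ.real (G₁ ∩ G₂ ∩ G₃) - μ.real (G₁ ∩ G₂) * μ.real G₃) := by
  ring

/-- **`μ(G₁)·LA = μ(G₁G₂)μ(G₁G₃)·E₃ + κ₁σ₃ − μ(G₁G₂)σ₂ρ₁₃`**. [this work] -/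
theorem mul_LA_eq_sahi :
    μ.real G₁ * (μ.real (G₁ ∩ G₂ ∩ G₃) ^ 2 - μ.real (G₁ ∩ G₂) * μ.real (G₁ ∩ G₃) * μ.real (G₂ ∩ G₃)) =
      μ.real (G₁ ∩ G₂) * μ.real (G₁ ∩ G₃) * sahiE3 μ G₁ G₂ G₃ +
        (μ.real (G₁ ∩ G₂ ∩ G₃) * μ.real G₁ - μ.real (G₁ ∩ G₂) * μ.real (G₁ ∩ G₃)) *
          (μ.real (G₁ ∩ G₂ ∩ G₃) - μ.real (G₁ ∩ G₂) * μ.real G₃) -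
        μ.real (G₁ ∩ G₂) * (μ.real (G₁ ∩ G₂ ∩ G₃) - μ.real (G₁ ∩ G₃) * μ.real G₂) *
          (μ.real (G₁ ∩ G₃) - μ.real G₁ * μ.real G₃) := by
  rw [sahiE3_def]; ring

end Identities

section ProductMeasure

variable {ι : Type*} [Fintype ι] (p : ι → unitInterval) {G₁ G₂ G₃ : Set (Set ι)}

/-- Conditional Harris at the shadow `G₃` (`μ(G₁G₂G₃)μ(G₃) ≥ μ(G₁G₃)μ(G₂G₃)`) gives Lemma A `μ(G₁G₂G₃)² ≥ Πμ(G_iG_j)` for up-sets under a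
product measure (the mechanism of the meet–join stratum). [this work] -/
theorem LA_nonneg_of_condHarris (h₁ : IsUpperSet G₁) (h₂ : IsUpperSet G₂) (h₃ : IsUpperSet G₃)
    (hκ : (prodBernoulli p).real (G₁ ∩ G₃) * (prodBernoulli p).real (G₂ ∩ G₃) ≤
      (prodBernoulli p).real (G₁ ∩ G₂ ∩ G₃) * (prodBernoulli p).real G₃) :
    (prodBernoulli p).real (G₁ ∩ G₂) * (prodBernoulli p).real (G₁ ∩ G₃) * (prodBernoulli p).real (G₂ ∩ G₃) ≤
      (prodBernoulli p).real (G₁ ∩ G₂ ∩ G₃) ^ 2 := by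
  have hσ := prodBernoulli_harris p (h₁.inter h₂) h₃ (GhostField.measurableSet_of_fintype _) (GhostField.measurableSet_of_fintype _)
  have h0 : 0 ≤ (prodBernoulli p).real (G₁ ∩ G₂) := measureReal_nonneg
  have ha : 0 ≤ (prodBernoulli p).real (G₁ ∩ G₂ ∩ G₃) := measureReal_nonneg
  have e := LA_eq_kappa_sigma (prodBernoulli p) G₁ G₂ G₃
  nlinarith [mul_nonneg h0 (sub_nonneg.2 hκ), mul_nonneg ha (sub_nonneg.2 hσ)]

/-- **(C1-law) on `{κ₁ ≤ 0}` implies Sahi's `E₃ ≥ 0` (multiplied form)**: for up-sets under a product measure, if conditional Harris FAILS at the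
shadow `G₁` (`κ₁ ≤ 0`) and Lemma A holds (`LA ≥ 0`), then `μ(G₁G₂)μ(G₁G₃)·E₃(G₁,G₂,G₃) ≥ 0`. [this work] -/
theorem sahiE3_mul_nonneg_of_LA_nonneg (h₁ : IsUpperSet G₁) (h₂ : IsUpperSet G₂) (h₃ : IsUpperSet G₃)
    (hκ : (prodBernoulli p).real (G₁ ∩ G₂ ∩ G₃) * (prodBernoulli p).real G₁ ≤
      (prodBernoulli p).real (G₁ ∩ G₂) * (prodBernoulli p).real (G₁ ∩ G₃))
    (hLA : (prodBernoulli p).real (G₁ ∩ G₂) * (prodBernoulli p).real (G₁ ∩ G₃) * (prodBernoulli p).real (G₂ ∩ G₃) ≤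
      (prodBernoulli p).real (G₁ ∩ G₂ ∩ G₃) ^ 2) :
    0 ≤ (prodBernoulli p).real (G₁ ∩ G₂) * (prodBernoulli p).real (G₁ ∩ G₃) * sahiE3 (prodBernoulli p) G₁ G₂ G₃ := by
  have m := fun (X : Set (Set ι)) => GhostField.measurableSet_of_fintype X
  -- Harris slacks
  have hσ₃ := prodBernoulli_harris p (h₁.inter h₂) h₃ (m _) (m _)          -- μ(G₁G₂)μ(G₃) ≤ μ(G₁G₂ ∩ G₃)
  have hσ₂' := prodBernoulli_harris p (h₁.inter h₃) h₂ (m _) (m _)         -- μ(G₁G₃)μ(G₂) ≤ μ(G₁G₃ ∩ G₂)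
  have hρ₁₃ := prodBernoulli_harris p h₁ h₃ (m _) (m _)                    -- μ(G₁)μ(G₃) ≤ μ(G₁ ∩ G₃)
  have e132 : G₁ ∩ G₃ ∩ G₂ = G₁ ∩ G₂ ∩ G₃ := by
    ext ω; simp only [Set.mem_inter_iff]; tauto
  rw [e132] at hσ₂'
  have hG₁ : 0 ≤ (prodBernoulli p).real G₁ := measureReal_nonneg
  have h12 : 0 ≤ (prodBernoulli p).real (G₁ ∩ G₂) := measureReal_nonneg
  have e := mul_LA_eq_sahi (prodBernoulli p) G₁ G₂ G₃
  -- μ(G₁)·LA ≥ 0, −κ₁σ₃ ≥ 0, μ(G₁G₂)σ₂ρ₁₃ ≥ 0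
  have t1 : 0 ≤ (prodBernoulli p).real G₁ * ((prodBernoulli p).real (G₁ ∩ G₂ ∩ G₃) ^ 2 -
      (prodBernoulli p).real (G₁ ∩ G₂) * (prodBernoulli p).real (G₁ ∩ G₃) * (prodBernoulli p).real (G₂ ∩ G₃)) :=
    mul_nonneg hG₁ (sub_nonneg.2 hLA)
  have t2 : 0 ≤ -(((prodBernoulli p).real (G₁ ∩ G₂ ∩ G₃) * (prodBernoulli p).real G₁ -
      (prodBernoulli p).real (G₁ ∩ G₂) * (prodBernoulli p).real (G₁ ∩ G₃)) *
      ((prodBernoulli p).real (G₁ ∩ G₂ ∩ G₃) - (prodBernoulli p).real (G₁ ∩ G₂) * (prodBernoulli p).real G₃)) := by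
    rw [neg_nonneg]
    exact mul_nonpos_of_nonpos_of_nonneg (sub_nonpos.2 hκ) (sub_nonneg.2 hσ₃)
  have t3 : 0 ≤ (prodBernoulli p).real (G₁ ∩ G₂) * ((prodBernoulli p).real (G₁ ∩ G₂ ∩ G₃) -
      (prodBernoulli p).real (G₁ ∩ G₃) * (prodBernoulli p).real G₂) *
      ((prodBernoulli p).real (G₁ ∩ G₃) - (prodBernoulli p).real G₁ * (prodBernoulli p).real G₃) :=
    mul_nonneg (mul_nonneg h12 (sub_nonneg.2 hσ₂')) (sub_nonneg.2 hρ₁₃)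
  linarith

/-- **(C1-law) on `{κ₁ ≤ 0}` implies Kahn's Conjecture 5 for the triple**: as above, with `μ(G₁G₂)μ(G₁G₃) > 0`, `0 ≤ E₃(G₁,G₂,G₃)`.
[cite: Kahn2022, Conj. 5 (arXiv p. 3)] -/
theorem sahiE3_nonneg_of_LA_nonneg (h₁ : IsUpperSet G₁) (h₂ : IsUpperSet G₂) (h₃ : IsUpperSet G₃)
    (hκ : (prodBernoulli p).real (G₁ ∩ G₂ ∩ G₃) * (prodBernoulli p).real G₁ ≤
      (prodBernoulli p).real (G₁ ∩ G₂) * (prodBernoulli p).real (G₁ ∩ G₃))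
    (hLA : (prodBernoulli p).real (G₁ ∩ G₂) * (prodBernoulli p).real (G₁ ∩ G₃) * (prodBernoulli p).real (G₂ ∩ G₃) ≤
      (prodBernoulli p).real (G₁ ∩ G₂ ∩ G₃) ^ 2)
    (hpos : 0 < (prodBernoulli p).real (G₁ ∩ G₂) * (prodBernoulli p).real (G₁ ∩ G₃)) :
    0 ≤ sahiE3 (prodBernoulli p) G₁ G₂ G₃ := by
  have h := sahiE3_mul_nonneg_of_LA_nonneg p h₁ h₂ h₃ hκ hLA
  rw [mul_assoc] at h
  exact nonneg_of_mul_nonneg_right (by simpa [mul_assoc, mul_comm, mul_left_comm] using h) hpos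

end ProductMeasure

end SahiCalibration

end Summit.CriticalPhenomena.PercolationContinuityZ3.Theorems.SunflowerPartition
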